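import Mathlib
import HarnessLib
import Literature.Probability.Process.PointStationaryLaw
import Literature.MathematicalPhysics.StatisticalMechanics.RootEnergy
import Literature.MathematicalPhysics.StatisticalMechanics.LennardJonesClusters
import Literature.MathematicalPhysics.StatisticalMechanics.BarlowStacking
import Literature.Geometry.DiscreteGeometry.KissingPatterns
import Summits.AtomisticToContinuum.Crystallization.Theorems.PalmUnimodularRigidityCruxesToPalmRigidity
import Summits.AtomisticToContinuum.Crystallization.Theorems.PalmUnimodularRigidityShellsToBarlowChart
import Summits.AtomisticToContinuum.Crystallization.Theorems.PalmUnimodularRigidityBenjaminiSchrammLimit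
import Summits.AtomisticToContinuum.Crystallization.Theorems.ExcessDecayLiouvilleCrysEnergyLimit

/-!
# Crux `GroundStatesChargePeriodic` (stmt-AtomisticToContinuum-2911) — the PIECES of the BC2 redirect and
# their PROVED assembly (crux-strategist workfile `Cruxes/GroundStatesChargePeriodic/Pieces.lean`, sorry-free)

Route `BenjaminiSchrammPeriodicSupport` (sub-problem `Crystallization`).  The shared finite-`N` hinge
`GroundStatesChargePeriodic` is the only open hypothesis of the route's deciding theorem, hence
summit-strength; it is REDIRECTED (BC2) to the typed decomposition

  `MinimiserShells ∧ LayeredLawsChargePeriodic  (∧ BenjaminiSchrammLimit ✓ ∧ CrysEnergyLimit ✓)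
      → GroundStatesChargePeriodic`,

whose two OPEN pieces are

* `MinimiserShells` — the shared Palm-side local-order crux stmt-AtomisticToContinuum-9225 (verbatim:
  a minimising point-stationary hard-core law has an fcc- or hcp-like first shell at the root, a.s.);
* `LayeredLawsChargePeriodic` — NEW: a minimising point-stationary hard-core law that is a.s. carried by
  a Barlow-layered configuration (every point close-packed, ONE global bond-graph chart from an ideal
  Barlow stacking) charges ONE periodic configuration `Q` at every scale (Radin's "periodic support",
  asked only of layered laws; no hcp-vs-fcc-vs-polytype classification is claimed),

and whose two CLOSED pieces (`BenjaminiSchrammLimit`, item 9230; `CrysEnergyLimit`, item 0626) are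
supplied here from their landed proofs.  This module deliberately does NOT import the route file
`Theses/BenjaminiSchrammPeriodicSupport.lean`: every statement is written out verbatim (each `def` below
is definitionally the route's / the sibling route's decl of the same name, checked by `Iff.rfl` where the
sibling file is in scope), so that the route file can import this module and render the split's glue
`theorem … : MinimiserShells → LayeredLawsChargePeriodic → GroundStatesChargePeriodic := <glue_by>`
without an import cycle.

Assembly (all proofs real, no `sorry`):
1. `periodicSupport_of_pieces : MinimiserShells → ShellsToBarlowChart → LayeredLawsChargePeriodic →
   PeriodicSupport` — good root shell a.s. (piece 1); hard-core configurations are locally finite, so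
   "everything shows at the root" (`ae_forall_map_sub_of_ae`, the landed Aldous–Lyons transfer) makes
   EVERY point close-packed a.s.; the robust layer theorem `ShellsToBarlowChart` (item 9227, PROVED:
   `ShellsToBarlowChart_of`) gives the Barlow chart; piece 2 charges one periodic `Q`.
2. `groundStatesChargePeriodic_of_subs : PeriodicSupport → BenjaminiSchrammLimit → CrysEnergyLimit →
   GroundStatesChargePeriodic` — the Benjamini–Schramm limit `P` of a ground-state sequence is minimising
   (`E_P[h] = lim E(φ j)/φ j = e*`), `PeriodicSupport` charges `Q`, and the density-transfer clause plus
   the deterministic two-triangle-inequality step `matched_periodic_of_matched_event` (radius `R + ε/2`,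
   tolerance `ε/2`) give `≥ ρ·N` matched particles frequently in `N`.
3. `groundStatesChargePeriodic_of_pieces : MinimiserShells → LayeredLawsChargePeriodic →
   GroundStatesChargePeriodic` — 1 ∘ 2 with the three landed inputs
   (`ShellsToBarlowChart_of`, `benjaminiSchrammLimit_proof`, `crysEnergyLimit_proof`).

References: D. Aldous, R. Lyons, *Processes on unimodular random networks*, EJP 12 (2007) §2;
D. Aldous, J. M. Steele, *The objective method* (2004); C. Radin, *Low temperature and the origin of
crystalline symmetry*, Int. J. Mod. Phys. B 1 (1987) and J. Stat. Phys. 35 (1984) (periodic support of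
ground-state measures); X. Blanc, M. Lewin, EMS Surv. Math. Sci. 2 (2015) §2.1.
-/

namespace Summit.AtomisticToContinuum.Crystallization.Cruxes.GroundStatesChargePeriodic.Pieces

open scoped Topology ENNReal
open Filter Set MeasureTheory Literature.MathematicalPhysics.StatisticalMechanics
  Literature.Probability.Process

/-! ## The pieces (verbatim statements) -/

/-- **Piece 1 (OPEN, shared item stmt-AtomisticToContinuum-9225 `MinimiserShells`, verbatim).**  For every
hard core `δ > 0` and every minimising point-stationary law `P` on rooted `δ`-hard-core configurations
of `ℝ³`, a.s. the first shell of the ROOT (points `y ≠ 0`, `‖y‖ ≤ 5a/4`) is `(a/100)`-close to the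
scaled fcc or hcp kissing pattern for some scale `a ∈ [9/10, 1]`. -/
def MinimiserShells : Prop :=
  ∀ δ : ℝ, 0 < δ → ∀ P : MeasureTheory.Measure (MeasureTheory.Measure (EuclideanSpace ℝ (Fin 3))), MeasureTheory.IsProbabilityMeasure P → (∀ᵐ μ ∂P, (∃ S : Set (EuclideanSpace ℝ (Fin 3)), (0 : EuclideanSpace ℝ (Fin 3)) ∈ S ∧ (∀ x ∈ S, ∀ y ∈ S, x ≠ y → δ ≤ dist x y) ∧ μ = (MeasureTheory.Measure.count : MeasureTheory.Measure (EuclideanSpace ℝ (Fin 3))).restrict S)) → (∀ g : MeasureTheory.Measure (EuclideanSpace ℝ (Fin 3)) → EuclideanSpace ℝ (Fin 3) → ENNReal, Measurable (Function.uncurry g) → ∫⁻ μ, ∫⁻ y, g μ y ∂μ ∂P = ∫⁻ μ, ∫⁻ y, g (MeasureTheory.Measure.map (fun z => z - y) μ) (-y) ∂μ ∂P) → (∫ μ, (∫ y, Literature.MathematicalPhysics.StatisticalMechanics.lennardJones ‖y‖ ∂μ) / 2 ∂P) ≤ (⨅ Q : Literature.MathematicalPhysics.StatisticalMechanics.PeriodicConfiguration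 3, Q.energyPerParticle Literature.MathematicalPhysics.StatisticalMechanics.lennardJones) → ∀ᵐ μ ∂P, (∃ a : ℝ, 9 / 10 ≤ a ∧ a ≤ 1 ∧ ∃ T : Finset (EuclideanSpace ℝ (Fin 3)), (↑T : Set (EuclideanSpace ℝ (Fin 3))) = {y : EuclideanSpace ℝ (Fin 3) | μ {y} ≠ 0 ∧ y ≠ 0 ∧ ‖y‖ ≤ 5 / 4 * a} ∧ (Literature.Geometry.DiscreteGeometry.ShellCloseTo (a / 100) T (Finset.image (fun v : EuclideanSpace ℝ (Fin 3) => a • v) Literature.Geometry.DiscreteGeometry.fccKissingPattern) ∨ Literature.Geometry.DiscreteGeometry.ShellCloseTo (a / 100) T (Finset.image (fun v : EuclideanSpace ℝ (Fin 3) => a • v) Literature.Geometry.DiscreteGeometry.hcpKissingPattern)))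

/-- **Piece 2 (OPEN, NEW crux `LayeredLawsChargePeriodic`).**  For every hard core `δ > 0` and every
minimising point-stationary law `P` on rooted `δ`-hard-core configurations of `ℝ³` (frame written through
the landed notions `IsRootedHardCore`, `IsPointStationaryLaw`, `rootEnergy`) which is a.s. LAYERED —
`μ = count|S` with every point of `S` close-packed (good fcc/hcp shell at scale `a ∈ [9/10,1]`,
tolerance `a/100`) and ONE global chart `Φ : barlowStacking 1 √(2/3) s → S` (a bijection from an ideal
Barlow stacking with Hägg word `s` matching unit model bonds with the pairs at distance `≤ 28/25`) —
there is ONE periodic configuration `Q` such that for all `R, ε > 0` the two-way `ε`-matching event of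
the configuration on `B(0,R)` with a rotated re-based copy `A (Q.points − q)`, `q ∈ Q.points`, has
positive `P`-measure.  (The conclusion is that of `PeriodicSupport`; the extra hypothesis is exactly the
conclusion of `MinimiserShells` transported to every point plus the PROVED layer theorem
`ShellsToBarlowChart`.) -/
def LayeredLawsChargePeriodic : Prop :=
  ∀ δ : ℝ, 0 < δ → ∀ P : MeasureTheory.Measure (MeasureTheory.Measure (EuclideanSpace ℝ (Fin 3))), MeasureTheory.IsProbabilityMeasure P → (∀ᵐ μ ∂P, Literature.Probability.Process.IsRootedHardCore δ μ) → Literature.Probability.Process.IsPointStationaryLaw P → (∫ μ, Literature.MathematicalPhysics.StatisticalMechanics.rootEnergy Literature.MathematicalPhysics.StatisticalMechanics.lennardJones μ ∂P) ≤ (⨅ Q : Literature.MathematicalPhysics.StatisticalMechanics.PeriodicConfiguration 3, Q.energyPerParticle Literature.MathematicalPhysics.StatisticalMechanics.lennardJones) → (∀ᵐ μ ∂P, ∃ S : Set (EuclideanSpace ℝ (Fin 3)), μ = (MeasureTheory.Measure.count : MeasureTheory.Measure (EuclideanSpace ℝ (Fin 3))).restrict S ∧ (∀ x ∈ S, (∃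 a : ℝ, 9 / 10 ≤ a ∧ a ≤ 1 ∧ ∃ T : Finset (EuclideanSpace ℝ (Fin 3)), (↑T : Set (EuclideanSpace ℝ (Fin 3))) = (fun y : EuclideanSpace ℝ (Fin 3) => y - x) '' {y : EuclideanSpace ℝ (Fin 3) | y ∈ S ∧ y ≠ x ∧ dist y x ≤ 5 / 4 * a} ∧ (Literature.Geometry.DiscreteGeometry.ShellCloseTo (a / 100) T (Finset.image (fun v : EuclideanSpace ℝ (Fin 3) => a • v) Literature.Geometry.DiscreteGeometry.fccKissingPattern) ∨ Literature.Geometry.DiscreteGeometry.ShellCloseTo (a / 100) T (Finset.image (fun v : EuclideanSpace ℝ (Fin 3) => a • v) Literature.Geometry.DiscreteGeometry.hcpKissingPattern)))) ∧ (∃ s : ℤ → ℤ, Literature.MathematicalPhysics.StatisticalMechanics.IsHaggSeq s ∧ ∃ Φ : EuclideanSpace ℝ (Fin 3) → EuclideanSpace ℝ (Fin 3), Set.BijOn Φ (Literature.MathematicalPhysics.StatisticalMechanics.barlowStacking 1 (Real.sqrt (2 / 3)) s) S ∧ ∀ p ∈ Literature.MathematicalPhysics.StatisticalMechanics.barlowStacking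 1 (Real.sqrt (2 / 3)) s, ∀ q ∈ Literature.MathematicalPhysics.StatisticalMechanics.barlowStacking 1 (Real.sqrt (2 / 3)) s, (dist p q = 1 ↔ (0 < dist (Φ p) (Φ q) ∧ dist (Φ p) (Φ q) ≤ 28 / 25)))) → ∃ Q : Literature.MathematicalPhysics.StatisticalMechanics.PeriodicConfiguration 3, ∀ R ε : ℝ, 0 < R → 0 < ε → 0 < P {μ | ∃ A : EuclideanSpace ℝ (Fin 3) →ₗᵢ[ℝ] EuclideanSpace ℝ (Fin 3), ∃ q ∈ Q.points, (∀ s ∈ Q.points, dist s q ≤ R → ∃ y : EuclideanSpace ℝ (Fin 3), μ {y} ≠ 0 ∧ dist y (A (s - q)) ≤ ε) ∧ (∀ y : EuclideanSpace ℝ (Fin 3), μ {y} ≠ 0 → ‖y‖ ≤ R → ∃ s ∈ Q.points, dist y (A (s - q)) ≤ ε)}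

/-- The route's thesis `PeriodicSupport` (item stmt-AtomisticToContinuum-12747, verbatim). -/
def PeriodicSupport : Prop :=
  ∀ δ : ℝ, 0 < δ → ∀ P : MeasureTheory.Measure (MeasureTheory.Measure (EuclideanSpace ℝ (Fin 3))), MeasureTheory.IsProbabilityMeasure P → (∀ᵐ μ ∂P, Literature.Probability.Process.IsRootedHardCore δ μ) → Literature.Probability.Process.IsPointStationaryLaw P → (∫ μ, Literature.MathematicalPhysics.StatisticalMechanics.rootEnergy Literature.MathematicalPhysics.StatisticalMechanics.lennardJones μ ∂P) ≤ (⨅ Q : Literature.MathematicalPhysics.StatisticalMechanics.PeriodicConfiguration 3, Q.energyPerParticle Literature.MathematicalPhysics.StatisticalMechanics.lennardJones) → ∃ Q : Literature.MathematicalPhysics.StatisticalMechanics.PeriodicConfiguration 3, ∀ R ε : ℝ, 0 < R → 0 < ε → 0 < P {μ | ∃ A : EuclideanSpace ℝ (Fin 3) →ₗᵢ[ℝ] EuclideanSpace ℝ (Fin 3), ∃ q ∈ Q.points, (∀ s ∈ Q.points, dist s q ≤ R → ∃ y : EuclideanSpace ℝ (Fin 3), μ {y} ≠ 0 ∧ dist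 y (A (s - q)) ≤ ε) ∧ (∀ y : EuclideanSpace ℝ (Fin 3), μ {y} ≠ 0 → ‖y‖ ≤ R → ∃ s ∈ Q.points, dist y (A (s - q)) ≤ ε)}

/-- **Piece 3 (CLOSED, item stmt-AtomisticToContinuum-9230 `BenjaminiSchrammLimit`, verbatim)** — proved:
`Summit.AtomisticToContinuum.Crystallization.Theorems.benjaminiSchrammLimit_proof`. -/
def BenjaminiSchrammLimit : Prop :=
  ∀ x : (N : ℕ) → (Fin N → EuclideanSpace ℝ (Fin 3)), (∀ N, Literature.MathematicalPhysics.StatisticalMechanics.IsGroundState Literature.MathematicalPhysics.StatisticalMechanics.lennardJones (x N)) → ∃ φ : ℕ → ℕ, StrictMono φ ∧ ∃ δ : ℝ, 0 < δ ∧ ∃ P : MeasureTheory.Measure (MeasureTheory.Measure (EuclideanSpace ℝ (Fin 3))), MeasureTheory.IsProbabilityMeasure P ∧ (∀ᵐ μ ∂P, (∃ S : Set (EuclideanSpace ℝ (Fin 3)), (0 : EuclideanSpace ℝ (Fin 3)) ∈ S ∧ (∀ x ∈ S, ∀ y ∈ S, x ≠ y → δ ≤ dist x y) ∧ μ = (MeasureTheory.Measure.count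 : MeasureTheory.Measure (EuclideanSpace ℝ (Fin 3))).restrict S)) ∧ (∀ g : MeasureTheory.Measure (EuclideanSpace ℝ (Fin 3)) → EuclideanSpace ℝ (Fin 3) → ENNReal, Measurable (Function.uncurry g) → ∫⁻ μ, ∫⁻ y, g μ y ∂μ ∂P = ∫⁻ μ, ∫⁻ y, g (MeasureTheory.Measure.map (fun z => z - y) μ) (-y) ∂μ ∂P) ∧ Filter.Tendsto (fun j : ℕ => Literature.MathematicalPhysics.StatisticalMechanics.groundStateEnergy Literature.MathematicalPhysics.StatisticalMechanics.lennardJones 3 (φ j) / (φ j : ℝ)) Filter.atTop (nhds (∫ μ, (∫ y, Literature.MathematicalPhysics.StatisticalMechanics.lennardJones ‖y‖ ∂μ) / 2 ∂P)) ∧ ∀ T : Set (MeasureTheory.Measure (EuclideanSpace ℝ (Fin 3))), ∀ R ε : ℝ, 0 < ε → ∀ ρ : ℝ, ρ < (P T).toReal → ∀ᶠ j : ℕ in Filter.atTop, ρ * (φ j : ℝ) ≤ (Nat.card {i : Fin (φ j) // ∃ ν ∈ T, ((∀ p : EuclideanSpace ℝ (Fin 3), ν {p} ≠ 0 → ‖p‖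 ≤ R → ∃ q ∈ (Set.range (fun k : Fin (φ j) => x (φ j) k - x (φ j) i)), dist q p ≤ ε) ∧ (∀ q ∈ (Set.range (fun k : Fin (φ j) => x (φ j) k - x (φ j) i)), ‖q‖ ≤ R → ∃ p : EuclideanSpace ℝ (Fin 3), ν {p} ≠ 0 ∧ dist q p ≤ ε))} : ℝ)

/-- **Piece 4 (CLOSED, item stmt-AtomisticToContinuum-0626 `CrysEnergyLimit`, verbatim)** — proved:
`Summit.AtomisticToContinuum.Crystallization.Theorems.crysEnergyLimit_proof`. -/
def CrysEnergyLimit : Prop :=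
  Filter.Tendsto (fun N : ℕ => Literature.MathematicalPhysics.StatisticalMechanics.groundStateEnergy Literature.MathematicalPhysics.StatisticalMechanics.lennardJones 3 N / N) Filter.atTop (nhds (⨅ Q : Literature.MathematicalPhysics.StatisticalMechanics.PeriodicConfiguration 3, Q.energyPerParticle Literature.MathematicalPhysics.StatisticalMechanics.lennardJones))

/-- The hinge `GroundStatesChargePeriodic` (item stmt-AtomisticToContinuum-2911, verbatim). -/
def GroundStatesChargePeriodic : Prop :=
  ∀ x : (N : ℕ) → (Fin N → EuclideanSpace ℝ (Fin 3)), (∀ N, Literature.MathematicalPhysics.StatisticalMechanics.IsGroundState Literature.MathematicalPhysics.StatisticalMechanics.lennardJones (x N)) → ∃ Q : Literature.MathematicalPhysics.StatisticalMechanics.PeriodicConfiguration 3, ∀ R ε : ℝ, 0 < R → 0 < ε → ∃ ρ : ℝ, 0 < ρ ∧ ∃ᶠ N : ℕ in Filter.atTop, ρ * (N : ℝ) ≤ (Nat.card {i : Fin N // ∃ A : EuclideanSpace ℝ (Fin 3) →ₗᵢ[ℝ] EuclideanSpace ℝ (Fin 3), ∃ q ∈ Q.points, (∀ s ∈ Q.points,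 dist s q ≤ R → ∃ j : Fin N, dist (x N j) (x N i + A (s - q)) ≤ ε) ∧ (∀ j : Fin N, dist (x N j) (x N i) ≤ R → ∃ s ∈ Q.points, dist (x N j) (x N i + A (s - q)) ≤ ε)} : ℝ)

/-! ## Sanity: the pieces shared with the sibling route are its decls, definitionally -/

example : MinimiserShells ↔
    Summit.AtomisticToContinuum.Crystallization.Theses.PalmUnimodularRigidity.MinimiserShells := Iff.rfl

example : BenjaminiSchrammLimit ↔
    Summit.AtomisticToContinuum.Crystallization.Theses.PalmUnimodularRigidity.BenjaminiSchrammLimit :=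
  Iff.rfl

example : CrysEnergyLimit ↔
    Summit.AtomisticToContinuum.Crystallization.Theses.PalmUnimodularRigidity.CrysEnergyLimit := Iff.rfl

example : GroundStatesChargePeriodic ↔
    Summit.AtomisticToContinuum.Crystallization.Theses.PalmUnimodularRigidity.GroundStatesChargePeriodic :=
  Iff.rfl

/-! ## The closed pieces, from the tree -/

/-- Piece 3 holds (item 9230, proved for route `PalmUnimodularRigidity`). -/
theorem benjaminiSchrammLimit_holds : BenjaminiSchrammLimit := by
  unfold BenjaminiSchrammLimit
  exact Summit.AtomisticToContinuum.Crystallization.Theorems.benjaminiSchrammLimit_proof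

/-- Piece 4 holds (item 0626, proved for route `ExcessDecayLiouville`). -/
theorem crysEnergyLimit_holds : CrysEnergyLimit := by
  unfold CrysEnergyLimit
  exact Summit.AtomisticToContinuum.Crystallization.Theorems.crysEnergyLimit_proof

/-- The robust layer theorem (item 9227 `ShellsToBarlowChart`, proved: `ShellsToBarlowChart_of`). -/
theorem shellsToBarlowChart_holds :
    Summit.AtomisticToContinuum.Crystallization.Theses.PalmUnimodularRigidity.ShellsToBarlowChart :=
  Summit.AtomisticToContinuum.Crystallization.Cruxes.ShellsToBarlowChart.DevelopTheModelGrowthDescent.ShellsToBarlowChart_of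

/-! ## The deterministic matching step -/

/-- **From a matched charged configuration to a matched periodic pattern.**  If the configuration
`ν` is two-way `(ε/2)`-matched on the ball of radius `R + ε/2` with the rotated, re-based periodic
point set `A (Q.points - q)`, and the recentred finite configuration `{x k - x i}` is two-way
`(ε/2)`-matched on the ball of radius `R + ε/2` with the atoms of `ν`, then the `R`-neighbourhood of
particle `i` is two-way `ε`-matched with `x i + A (Q.points - q)` — the matching clause of
`GroundStatesChargePeriodic`. [folklore] -/
theorem matched_periodic_of_matched_event {N : ℕ} (x : Fin N → EuclideanSpace ℝ (Fin 3))
    (i : Fin N) (Q : PeriodicConfiguration 3) {R ε : ℝ} (hε : 0 ≤ ε)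
    (ν : Measure (EuclideanSpace ℝ (Fin 3)))
    (A : EuclideanSpace ℝ (Fin 3) →ₗᵢ[ℝ] EuclideanSpace ℝ (Fin 3))
    {q : EuclideanSpace ℝ (Fin 3)}
    (hQ1 : ∀ s ∈ Q.points, dist s q ≤ R + ε / 2 →
      ∃ y : EuclideanSpace ℝ (Fin 3), ν {y} ≠ 0 ∧ dist y (A (s - q)) ≤ ε / 2)
    (hQ2 : ∀ y : EuclideanSpace ℝ (Fin 3), ν {y} ≠ 0 → ‖y‖ ≤ R + ε / 2 →
      ∃ s ∈ Q.points, dist y (A (s - q)) ≤ ε / 2)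
    (h1 : ∀ p : EuclideanSpace ℝ (Fin 3), ν {p} ≠ 0 → ‖p‖ ≤ R + ε / 2 →
      ∃ q' ∈ Set.range (fun k : Fin N => x k - x i), dist q' p ≤ ε / 2)
    (h2 : ∀ q' ∈ Set.range (fun k : Fin N => x k - x i), ‖q'‖ ≤ R + ε / 2 →
      ∃ p : EuclideanSpace ℝ (Fin 3), ν {p} ≠ 0 ∧ dist q' p ≤ ε / 2) :
    (∀ s ∈ Q.points, dist s q ≤ R → ∃ j : Fin N, dist (x j) (x i + A (s - q)) ≤ ε) ∧
      (∀ j : Fin N, dist (x j) (x i) ≤ R → ∃ s ∈ Q.points, dist (x j) (x i + A (s - q)) ≤ ε) := by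
  have hkey : ∀ (j : Fin N) (s : EuclideanSpace ℝ (Fin 3)),
      dist (x j) (x i + A (s - q)) = dist (x j - x i) (A (s - q)) := by
    intro j s
    rw [dist_eq_norm, dist_eq_norm, sub_add_eq_sub_sub]
  have hnA : ∀ s : EuclideanSpace ℝ (Fin 3), ‖A (s - q)‖ = dist s q := by
    intro s
    rw [LinearIsometry.norm_map, dist_eq_norm]
  constructor
  · intro s hs hsR
    obtain ⟨y, hy, hyd⟩ := hQ1 s hs (by linarith)
    have hyn : ‖y‖ ≤ R + ε / 2 := by
      calc ‖y‖ = dist y 0 := (dist_zero_right _).symm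
        _ ≤ dist y (A (s - q)) + dist (A (s - q)) 0 := dist_triangle _ _ _
        _ ≤ ε / 2 + R := by
            rw [dist_zero_right, hnA]; exact add_le_add hyd hsR
        _ = R + ε / 2 := by ring
    obtain ⟨q', ⟨k, rfl⟩, hk⟩ := h1 y hy hyn
    refine ⟨k, ?_⟩
    rw [hkey]
    calc dist (x k - x i) (A (s - q)) ≤ dist (x k - x i) y + dist y (A (s - q)) :=
          dist_triangle _ _ _
      _ ≤ ε / 2 + ε / 2 := add_le_add hk hyd
      _ = ε := by ring
  · intro j hj
    have hq' : x j - x i ∈ Set.range (fun k : Fin N => x k - x i) := ⟨j, rfl⟩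
    have hq'n : ‖x j - x i‖ ≤ R + ε / 2 := by
      rw [← dist_eq_norm]; linarith
    obtain ⟨p, hp, hpd⟩ := h2 _ hq' hq'n
    have hpn : ‖p‖ ≤ R + ε / 2 := by
      calc ‖p‖ = dist p 0 := (dist_zero_right _).symm
        _ ≤ dist p (x j - x i) + dist (x j - x i) 0 := dist_triangle _ _ _
        _ ≤ ε / 2 + R := by
            rw [dist_zero_right, dist_comm, ← dist_eq_norm]; exact add_le_add hpd hj
        _ = R + ε / 2 := by ring
    obtain ⟨s, hs, hsd⟩ := hQ2 p hp hpn
    refine ⟨s, hs, ?_⟩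
    rw [hkey]
    calc dist (x j - x i) (A (s - q)) ≤ dist (x j - x i) p + dist p (A (s - q)) :=
          dist_triangle _ _ _
      _ ≤ ε / 2 + ε / 2 := add_le_add hpd hsd
      _ = ε := by ring

/-! ## The assembly of the split -/

/-- **The typed split of the hinge** (route `BenjaminiSchrammPeriodicSupport`, layer 2):
`PeriodicSupport → BenjaminiSchrammLimit → CrysEnergyLimit → GroundStatesChargePeriodic`.
Periodic support of the minimising point-stationary hard-core laws (the Palm-side crux), the
Benjamini–Schramm limit of the ground states (construction, proved) and the energy limit
`E(N)/N → e*` (proved) give ONE periodic configuration charged with positive density at every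
scale, frequently in `N`. [AldousLyons2007 §2; AldousSteele2004; BlancLewin2015 §2.1] -/
theorem groundStatesChargePeriodic_of_subs :
    PeriodicSupport → BenjaminiSchrammLimit → CrysEnergyLimit → GroundStatesChargePeriodic := by
  intro hPS hBS hLim x hx
  obtain ⟨φ, hφ, δ, hδ, P, hP, hcore, hstat, hE, htr⟩ := hBS x hx
  -- the Benjamini–Schramm limit is minimising: `E_P[h] = lim E(φ j)/φ j = e*`
  have hlim' : Tendsto (fun j : ℕ => groundStateEnergy lennardJones 3 (φ j) / (φ j : ℝ)) atTop
      (𝓝 (⨅ Q : PeriodicConfiguration 3, Q.energyPerParticle lennardJones)) :=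
    hLim.comp hφ.tendsto_atTop
  have hEq := tendsto_nhds_unique hE hlim'
  -- fold the frame of `BenjaminiSchrammLimit` into the three landed notions
  have hcore' : ∀ᵐ μ ∂P, Literature.Probability.Process.IsRootedHardCore δ μ := hcore
  have hstat' : Literature.Probability.Process.IsPointStationaryLaw P := hstat
  have hmin : (∫ μ, rootEnergy lennardJones μ ∂P) ≤
      ⨅ Q : PeriodicConfiguration 3, Q.energyPerParticle lennardJones := hEq.le
  -- ONE periodic configuration charged at every scale
  obtain ⟨Q, hQ⟩ := hPS δ hδ P hP hcore' hstat' hmin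
  refine ⟨Q, fun R ε hR hε => ?_⟩
  -- the matching event at radius `R + ε/2`, tolerance `ε/2`
  set T : Set (Measure (EuclideanSpace ℝ (Fin 3))) :=
    {μ | ∃ A : EuclideanSpace ℝ (Fin 3) →ₗᵢ[ℝ] EuclideanSpace ℝ (Fin 3), ∃ q ∈ Q.points,
      (∀ s ∈ Q.points, dist s q ≤ R + ε / 2 →
        ∃ y : EuclideanSpace ℝ (Fin 3), μ {y} ≠ 0 ∧ dist y (A (s - q)) ≤ ε / 2) ∧
      (∀ y : EuclideanSpace ℝ (Fin 3), μ {y} ≠ 0 → ‖y‖ ≤ R + ε / 2 →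
        ∃ s ∈ Q.points, dist y (A (s - q)) ≤ ε / 2)} with hTdef
  have hT : 0 < P T := hQ (R + ε / 2) (ε / 2) (by positivity) (half_pos hε)
  have hTreal : 0 < (P T).toReal := ENNReal.toReal_pos hT.ne' (measure_ne_top P T)
  refine ⟨(P T).toReal / 2, half_pos hTreal, ?_⟩
  have hev := htr T (R + ε / 2) (ε / 2) (half_pos hε) ((P T).toReal / 2) (half_lt_self hTreal)
  -- the property transferred to `N = φ j`
  set good : (N : ℕ) → Fin N → Prop := fun N i =>
    ∃ A : EuclideanSpace ℝ (Fin 3) →ₗᵢ[ℝ] EuclideanSpace ℝ (Fin 3), ∃ q ∈ Q.points,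
      (∀ s ∈ Q.points, dist s q ≤ R → ∃ j : Fin N, dist (x N j) (x N i + A (s - q)) ≤ ε) ∧
      (∀ j : Fin N, dist (x N j) (x N i) ≤ R →
        ∃ s ∈ Q.points, dist (x N j) (x N i + A (s - q)) ≤ ε)
    with hgood
  have himp : ∀ (N : ℕ) (i : Fin N),
      (∃ ν ∈ T, ((∀ p : EuclideanSpace ℝ (Fin 3), ν {p} ≠ 0 → ‖p‖ ≤ R + ε / 2 →
          ∃ q ∈ (Set.range (fun k : Fin N => x N k - x N i)), dist q p ≤ ε / 2) ∧
        (∀ q ∈ (Set.range (fun k : Fin N => x N k - x N i)), ‖q‖ ≤ R + ε / 2 →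
          ∃ p : EuclideanSpace ℝ (Fin 3), ν {p} ≠ 0 ∧ dist q p ≤ ε / 2))) → good N i := by
    rintro N i ⟨ν, ⟨A, q, hq, hQ1, hQ2⟩, h1, h2⟩
    obtain ⟨c1, c2⟩ := matched_periodic_of_matched_event (x N) i Q hε.le ν A hQ1 hQ2 h1 h2
    exact ⟨A, q, hq, c1, c2⟩
  have hev' : ∀ᶠ j : ℕ in atTop,
      (P T).toReal / 2 * ((φ j : ℕ) : ℝ) ≤ (Nat.card {i : Fin (φ j) // good (φ j) i} : ℝ) := by
    filter_upwards [hev] with j hj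
    refine hj.trans ?_
    exact_mod_cast Nat.card_le_card_of_injective _
      (Subtype.map_injective (fun i hi => himp (φ j) i hi) Function.injective_id)
  exact hφ.tendsto_atTop.frequently
    (p := fun N : ℕ => (P T).toReal / 2 * (N : ℝ) ≤ (Nat.card {i : Fin N // good N i} : ℝ))
    hev'.frequently

/-! ## From the two open pieces to the thesis `PeriodicSupport` -/

/-- **Measure-level composition.**  Local structure a.s. at the root (piece 1), everything shows at the
root (Aldous–Lyons transfer, landed: `ae_forall_map_sub_of_ae`), the robust layer theorem
`ShellsToBarlowChart` (item 9227) and periodic charging of layered minimising laws (piece 2) give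
`PeriodicSupport`. [AldousLyons2007 §2, Lemma 2.3] -/
theorem periodicSupport_of_pieces (hShells : MinimiserShells)
    (hChart : Summit.AtomisticToContinuum.Crystallization.Theses.PalmUnimodularRigidity.ShellsToBarlowChart)
    (hSelect : LayeredLawsChargePeriodic) : PeriodicSupport := by
  intro δ hδ P hP hcore hstat hmin
  -- good root shell, a.s. (piece 1, through the definitional folding of the frame)
  have hroot := hShells δ hδ P hP hcore hstat hmin
  -- hard-core configurations are locally finite
  have hlf : ∀ᵐ μ ∂P, ∀ n : ℕ,
      μ ((fun z : EuclideanSpace ℝ (Fin 3) => ⌊‖z‖⌋₊) ⁻¹' {n}) < ∞ := by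
    filter_upwards [hcore] with μ hμ n
    obtain ⟨S, -, hsep, rfl⟩ := hμ
    exact Summit.AtomisticToContinuum.Crystallization.Theorems.PalmUnimodularRigidity.count_restrict_floorNorm_preimage_lt_top
      hδ hsep n
  -- good shell at every point, a.s. (everything shows at the root)
  have hall := Summit.AtomisticToContinuum.Crystallization.Theorems.PalmUnimodularRigidity.ae_forall_map_sub_of_ae
    hstat hlf hroot
  refine hSelect δ hδ P hP hcore hstat hmin ?_
  filter_upwards [hcore, hall] with μ hc ha
  obtain ⟨S, h0, hsep, rfl⟩ := hc
  refine ⟨S, rfl, ?good, hChart S ⟨0, h0⟩ ?good⟩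
  intro x hx
  obtain ⟨a, ha1, ha2, T, hT, hsh⟩ := ha x ((count_restrict_singleton_ne_zero_iff S x).2 hx)
  refine ⟨a, ha1, ha2, T, ?_, hsh⟩
  rw [hT, map_sub_count_restrict,
    Summit.AtomisticToContinuum.Crystallization.Theorems.PalmUnimodularRigidity.shell_image_sub_eq]

/-! ## The glue of the split (the `glue_by` theorem) -/

/-- **The four-piece assembly**: `MinimiserShells → LayeredLawsChargePeriodic → BenjaminiSchrammLimit →
CrysEnergyLimit → GroundStatesChargePeriodic` (sorry-free; the layer theorem 9227 is taken from the tree). -/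
theorem groundStatesChargePeriodic_of_four (hShells : MinimiserShells)
    (hSelect : LayeredLawsChargePeriodic) (hBS : BenjaminiSchrammLimit) (hLim : CrysEnergyLimit) :
    GroundStatesChargePeriodic :=
  groundStatesChargePeriodic_of_subs (periodicSupport_of_pieces hShells shellsToBarlowChart_holds hSelect)
    hBS hLim

/-- **THE GLUE OF THE SPLIT (`glue_by`)**: `MinimiserShells → LayeredLawsChargePeriodic →
GroundStatesChargePeriodic`, the two closed pieces being supplied from the tree
(`benjaminiSchrammLimit_proof`, `crysEnergyLimit_proof`).  Its type is definitionally
`Theses.BenjaminiSchrammPeriodicSupport.MinimiserShells → ….LayeredLawsChargePeriodic →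
….GroundStatesChargePeriodic` once the split renders the two children in the route file. -/
theorem groundStatesChargePeriodic_of_pieces :
    MinimiserShells → LayeredLawsChargePeriodic → GroundStatesChargePeriodic :=
  fun hShells hSelect =>
    groundStatesChargePeriodic_of_four hShells hSelect benjaminiSchrammLimit_holds crysEnergyLimit_holds

end Summit.AtomisticToContinuum.Crystallization.Cruxes.GroundStatesChargePeriodic.Pieces
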